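import Summits.NavierStokesRegularity.FluidComputer.PalasekTowerHostSchedule

/-!
# Host preparation, IX: the host flow solves forced Navier–Stokes on `[0, 1]`; sizes

Cell `ns-blowup`, seat `ns-blowup-ecbridge-3` (g0); GROUP C «BRIDGE SUPPORT» of the route
`PalasekTowerBreakdown` (crux `EpisodeBaseG`, item stmt-NavierStokesRegularity-19179, BC3 stub
`host_preparation` = the tree Prop `RungG 0`). LABEL: E–C typing (KERNEL construction). WHAT THIS
IS NOT: not Navier–Stokes evidence — the velocity is PRESCRIBED and the force is DEFINED as its
residual, so "solves the forced system" is an algebraic identity (Lamb form + strong Beltrami +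
`Δ = −curl curl`), not dynamics; nothing is claimed about what happens after `τ₀ = 1`.

* §1 kinematics of `u = a • bumpF + b • slab`: the two pieces have disjoint supports
  (`vel_off_slab`, `vel_off_bump`), so `(u·∇)u = a² (bumpF·∇)bumpF + b² (slab·∇)slab`; time
  derivative, Jacobian, Laplacian, pressure gradient, divergence;
* §2 **the momentum identity** `∂ₜu + (u·∇)u = Δu − ∇p + resid` on `[0, 1] × ℝ³` and the classical
  solution structure `IsClassicalNSSolutionOn (Icc 0 1) 1 (force L L_b) (vel L L_b) (pres L)`
  (`force = resid` there);
* §3 sizes: `u(0) = 0`; under the slab-size hypothesis `‖slab‖ ≤ (11/10) λ` the speed is `≤ Y₀`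
  everywhere on `[0, 1]` (ceiling `(5/3) Y₀`) and `< Y₀` before `t = 1` (the GLOBAL ANCHOR); the
  floor `‖u(1, c + L_b x⋆)‖ = Y₀`; the strain `‖Du(1)(0)‖ ≥ A₀ = N₀ Y₀`; finite energy on the slab.

References: S. Palasek, arXiv:2605.13827 §3.3–§4 [cite: Palasek2026ElementaryModel, §4];
A. J. Majda, A. L. Bertozzi, *Vorticity and Incompressible Flow* (CUP 2002), §2.3.2
[cite: MajdaBertozziCUP2002, §2.3.2]; C. L. Fefferman, Clay problem description, (1)–(2)
[cite: FeffermanClay2006, (1) (2)].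
-/

noncomputable section

namespace Summit.NavierStokesRegularity.FluidComputer.PalasekTowerClayBridge.Host

open Real Set Function Filter Topology InnerProductSpace Metric MeasureTheory
open scoped RealInnerProductSpace ContDiff Topology Laplacian ENNReal

open Literature.Analysis.FluidPDE
open Literature.Analysis.FluidPDE.DistributionalToWeakCounterexample (θ θ_contDiff θ_isDivFree)

/-- Local notation for physical space `ℝ³ = EuclideanSpace ℝ (Fin 3)`. -/
local notation "ℝ³" => EuclideanSpace ℝ (Fin 3)

section Flow

variable {L Lb : ℝ}

/-! ## §1 Kinematics -/

/-- Off the slab the velocity is the bump part. [folklore] -/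
theorem vel_off_slab (hL : 0 < L) {x : ℝ³} (hx : 2 * L < ‖x‖) (t : ℝ) :
    vel L Lb t x = aProf t • bumpF L Lb x := by
  rw [vel, (slab_zero hL hx).1, smul_zero, add_zero]

/-- Off the bump the velocity is the slab part. [folklore] -/
theorem vel_off_bump (hLb : 0 < Lb) {x : ℝ³} (hx : 2 * Lb < ‖x - center L Lb‖) (t : ℝ) :
    vel L Lb t x = bProf t • slab L x := by
  rw [vel, (bump_zero (L := L) hLb hx).1, smul_zero, zero_add]

/-- The time lines of the velocity are differentiable with the expected derivative. [folklore] -/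
theorem hasDerivAt_vel (t : ℝ) (x : ℝ³) :
    HasDerivAt (fun s => vel L Lb s x)
      (deriv aProf t • bumpF L Lb x + deriv bProf t • slab L x) t :=
  ((differentiable_aProf t).hasDerivAt.smul_const (bumpF L Lb x)).add
    ((differentiable_bProf t).hasDerivAt.smul_const (slab L x))

/-- **The one-sided time derivative within `[0, 1]`.** [folklore] -/
theorem timeDerivWithin_vel {t : ℝ} (ht : t ∈ Icc (0 : ℝ) 1) (x : ℝ³) :
    timeDerivWithin (Icc 0 1) (vel L Lb) t x = deriv aProf t • bumpF L Lb x + deriv bProf t • slab L x := by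
  rw [timeDerivWithin_apply]
  exact (hasDerivAt_vel t x).hasDerivWithinAt.derivWithin (uniqueDiffOn_Icc zero_lt_one t ht)

/-- **The Jacobian of the velocity.** [folklore] -/
theorem fderiv_vel (t : ℝ) (x : ℝ³) :
    fderiv ℝ (vel L Lb t) x = aProf t • fderiv ℝ (bumpF L Lb) x + bProf t • fderiv ℝ (slab L) x := by
  have hb := differentiable_bumpF (L := L) (Lb := Lb) x
  have hs := differentiable_slab (L := L) x
  have hb' : DifferentiableAt ℝ (fun y => aProf t • bumpF L Lb y) x := hb.const_smul (aProf t)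
  have hs' : DifferentiableAt ℝ (fun y => bProf t • slab L y) x := hs.const_smul (bProf t)
  show fderiv ℝ (fun y => aProf t • bumpF L Lb y + bProf t • slab L y) x = _
  rw [fderiv_fun_add hb' hs', fderiv_fun_const_smul hb, fderiv_fun_const_smul hs]

/-- The velocity slices are differentiable. [folklore] -/
theorem contDiff_vel (t : ℝ) : ContDiff ℝ ∞ (vel L Lb t) :=
  show ContDiff ℝ ∞ (fun y => aProf t • bumpF L Lb y + bProf t • slab L y) from
    (contDiff_bumpF.const_smul _).add (contDiff_slab.const_smul _)

/-- The velocity slices are differentiable. [folklore] -/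
theorem differentiable_vel (t : ℝ) : Differentiable ℝ (vel L Lb t) :=
  (contDiff_vel t).differentiable (by simp)

/-- **The nonlinearity splits**: `(u·∇)u = a² (bumpF·∇)bumpF + b² (slab·∇)slab` (disjoint supports).
[folklore] -/
theorem convect_vel (hL : 0 < L) (hLb : 0 < Lb) (t : ℝ) (x : ℝ³) :
    convect (vel L Lb t) (vel L Lb t) x =
      aProf t ^ 2 • convect (bumpF L Lb) (bumpF L Lb) x + bProf t ^ 2 • convect (slab L) (slab L) x := by
  rw [convect_apply, fderiv_vel, convect_apply, convect_apply]
  rcases off_slab_or_off_bump hL hLb x with h | h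
  · obtain ⟨hs0, hDs0, -, -⟩ := slab_zero hL h
    rw [vel, hs0, hDs0]
    simp [smul_smul, sq]
  · obtain ⟨hb0, hDb0, -, -⟩ := bump_zero (L := L) hLb h
    rw [vel, hb0, hDb0]
    simp [smul_smul, sq]

/-- **The Laplacian of the velocity.** [folklore] -/
theorem laplacian_vel (t : ℝ) (x : ℝ³) :
    (Δ (vel L Lb t)) x = aProf t • (Δ (bumpF L Lb)) x + bProf t • (Δ (slab L)) x := by
  have e : vel L Lb t = (aProf t • bumpF L Lb) + (bProf t • slab L) := by funext y; rfl
  have hb2 : ContDiff ℝ 2 (bumpF L Lb) := contDiff_bumpF.of_le (by norm_cast)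
  have hs2 : ContDiff ℝ 2 (slab L) := contDiff_slab.of_le (by norm_cast)
  have h1 : ContDiffAt ℝ 2 (aProf t • bumpF L Lb) x := (hb2.const_smul (aProf t)).contDiffAt
  have h2 : ContDiffAt ℝ 2 (bProf t • slab L) x := (hs2.const_smul (bProf t)).contDiffAt
  rw [e, h1.laplacian_add h2, InnerProductSpace.laplacian_smul _ hb2.contDiffAt,
    InnerProductSpace.laplacian_smul _ hs2.contDiffAt]

/-- **The pressure gradient** `∇p(t) = −b(t)² ∇(½|slab|²)`. [folklore] -/
theorem gradient_pres (t : ℝ) (x : ℝ³) :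
    gradient (pres L t) x = (-(bProf t ^ 2)) • gradient (fun y => ‖slab L y‖ ^ 2 / 2) x := by
  have hv : DifferentiableAt ℝ (slab L) x := differentiable_slab x
  have hg : HasGradientAt (fun y => ‖slab L y‖ ^ 2 / 2)
      (gradient (fun y => ‖slab L y‖ ^ 2 / 2) x) x :=
    (hasFDerivAt_half_norm_sq hv).differentiableAt.hasGradientAt
  have h : HasGradientAt (fun y => (-(bProf t ^ 2)) * (‖slab L y‖ ^ 2 / 2))
      ((-(bProf t ^ 2)) • gradient (fun y => ‖slab L y‖ ^ 2 / 2) x) x := by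
    rw [hasGradientAt_iff_hasFDerivAt] at hg ⊢
    refine (hg.const_mul (-(bProf t ^ 2))).congr_fderiv ?_
    rw [map_smul]
  exact h.gradient

/-- **The velocity is divergence free.** [folklore] -/
theorem isDivFree_vel (t : ℝ) : VectorCalculus.IsDivFree (vel L Lb t) := fun x => by
  have h1 : VectorCalculus.divergence (bumpF L Lb) x = 0 :=
    (isDivFree_place theta_differentiable θ_isDivFree : VectorCalculus.IsDivFree (bumpF L Lb)) x
  have h2 : VectorCalculus.divergence (slab L) x = 0 :=
    (isDivFree_packet (contDiff_cutoff L) : VectorCalculus.IsDivFree (slab L)) x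
  unfold VectorCalculus.divergence at h1 h2 ⊢
  rw [fderiv_vel]
  simp [h1, h2]

/-! ## §2 The momentum identity and the classical solution -/

/-- **THE MOMENTUM IDENTITY** of the host on `[0, 1] × ℝ³` at unit viscosity:
`∂ₜu + (u·∇)u = Δu − ∇p + resid` — Lamb form of the slab, `Δ slab = −(λ² slab + λR + curl R)`,
`Δ bumpF = −curl curl bumpF`, and the definition of `resid`. [folklore] -/
theorem momentum_vel (hL : 0 < L) (hLb : 0 < Lb) {t : ℝ} (ht : t ∈ Icc (0 : ℝ) 1) (x : ℝ³) :
    timeDerivWithin (Icc 0 1) (vel L Lb) t x + convect (vel L Lb t) (vel L Lb t) x =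
      (1 : ℝ) • (Δ (vel L Lb t)) x - gradient (pres L t) x + resid L Lb t x := by
  have hΔb : (Δ (bumpF L Lb)) x = -curl (curl (bumpF L Lb)) x := laplacian_place_theta _ _ _
  have hΔs : (Δ (slab L)) x =
      -(freq ^ 2 • slab L x + freq • slabDefect L x + curl (slabDefect L) x) :=
    laplacian_packet (contDiff_cutoff L) x
  have hcv : convect (slab L) (slab L) x =
      cross (slabDefect L x) (slab L x) + gradient (fun y => ‖slab L y‖ ^ 2 / 2) x :=
    convect_packet (contDiff_cutoff L) x
  rw [timeDerivWithin_vel ht, convect_vel hL hLb, laplacian_vel, gradient_pres, one_smul, hΔb, hΔs,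
    hcv]
  simp only [resid]
  module

/-- **The host is a classical solution of forced Navier–Stokes on `[0, 1] × ℝ³`** with force
`force L L_b` (`= resid` there), at unit viscosity. [cite: FeffermanClay2006, (1) (2)] -/
theorem isClassicalNSSolutionOn_vel (hL : 0 < L) (hLb : 0 < Lb) :
    IsClassicalNSSolutionOn (Icc 0 1) 1 (force L Lb) (vel L Lb) (pres L) where
  smooth_velocity := contDiff_uncurry_vel.contDiffOn
  smooth_pressure := contDiff_uncurry_pres.contDiffOn
  momentum t ht x := by
    rw [force_eq_resid ht.2]
    exact momentum_vel hL hLb ht x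
  divFree t _ := isDivFree_vel t

/-! ## §3 Sizes -/

/-- **The datum is zero**: `u(0) = 0`. [folklore] -/
theorem vel_zero : vel L Lb 0 = 0 := by
  funext x
  rw [vel, aProf_of_nonpos le_rfl, bProf_of_le_half (by norm_num), zero_smul, zero_smul, add_zero]
  rfl

/-- The slab part is at most `(33/40) Y₀` when `‖slab‖ ≤ (11/10) λ`. [folklore] -/
theorem norm_slab_part_le (hslab : ∀ y, ‖slab L y‖ ≤ 11 / 10 * freq) (t : ℝ) (x : ℝ³) :
    ‖bProf t • slab L x‖ ≤ 33 / 40 * TowerRates.wide.Y 0 := by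
  rw [norm_smul, Real.norm_eq_abs, abs_of_nonneg (bProf_nonneg t)]
  have h1 := bProf_le t
  have h2 := hslab x
  have h3 := ampSlab_mul_freq
  have h4 := ampSlab_pos
  calc bProf t * ‖slab L x‖ ≤ (3 / 2 * ampSlab) * (11 / 10 * freq) :=
        mul_le_mul h1 h2 (norm_nonneg _) (by positivity)
    _ = 33 / 40 * (2 * (ampSlab * freq)) := by ring
    _ = 33 / 40 * TowerRates.wide.Y 0 := by rw [h3]; ring

/-- The bump part is at most `Y₀`. [folklore] -/
theorem norm_bump_part_le (t : ℝ) (x : ℝ³) : ‖aProf t • bumpF L Lb x‖ ≤ TowerRates.wide.Y 0 := by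
  rw [norm_smul, Real.norm_eq_abs, abs_of_nonneg (aProf_nonneg t), ← ampBump_mul_thetaMax]
  exact mul_le_mul (aProf_le t) (norm_place_theta_le _ _ _) (norm_nonneg _) ampBump_pos.le

/-- **Speed bound**: `‖u(t, x)‖ ≤ Y₀` everywhere (`L, L_b > 0`, `‖slab‖ ≤ (11/10) λ`). [folklore] -/
theorem norm_vel_le (hL : 0 < L) (hLb : 0 < Lb) (hslab : ∀ y, ‖slab L y‖ ≤ 11 / 10 * freq)
    (t : ℝ) (x : ℝ³) : ‖vel L Lb t x‖ ≤ TowerRates.wide.Y 0 := by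
  rcases off_slab_or_off_bump hL hLb x with h | h
  · rw [vel_off_slab hL h]
    exact norm_bump_part_le t x
  · rw [vel_off_bump hLb h]
    have := wide_Y_zero_pos
    linarith [norm_slab_part_le hslab t x]

/-- **THE GLOBAL ANCHOR**: before `t = 1` the speed is `< Y₀` everywhere (the bump ramp is `< 1`,
the slab part `≤ (33/40) Y₀`). [folklore] -/
theorem norm_vel_lt (hL : 0 < L) (hLb : 0 < Lb) (hslab : ∀ y, ‖slab L y‖ ≤ 11 / 10 * freq)
    {t : ℝ} (ht : t < 1) (x : ℝ³) : ‖vel L Lb t x‖ < TowerRates.wide.Y 0 := by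
  rcases off_slab_or_off_bump hL hLb x with h | h
  · rw [vel_off_slab hL h, norm_smul, Real.norm_eq_abs, abs_of_nonneg (aProf_nonneg t),
      ← ampBump_mul_thetaMax]
    calc aProf t * ‖bumpF L Lb x‖ ≤ aProf t * thetaMax :=
          mul_le_mul_of_nonneg_left (norm_place_theta_le _ _ _) (aProf_nonneg t)
      _ < ampBump * thetaMax := mul_lt_mul_of_pos_right (aProf_lt ht) thetaMax_pos
  · rw [vel_off_bump hLb h]
    have := wide_Y_zero_pos
    linarith [norm_slab_part_le hslab t x]

/-- **Finite energy on the slab**: the velocity is bounded by `Y₀` and supported in `B̄(0, radius)`.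
[folklore] -/
theorem energy_vel (hL : 0 < L) (hLb : 0 < Lb) (hslab : ∀ y, ‖slab L y‖ ≤ 11 / 10 * freq) :
    ∃ C : ℝ≥0∞, C < ⊤ ∧ ∀ t ∈ Icc (0 : ℝ) 1, ∫⁻ x, ‖vel L Lb t x‖ₑ ^ 2 ≤ C := by
  set B := Metric.closedBall (0 : ℝ³) (radius L Lb) with hB
  refine ⟨ENNReal.ofReal (TowerRates.wide.Y 0) ^ 2 * volume B,
    ENNReal.mul_lt_top (by simp) measure_closedBall_lt_top, fun t _ => ?_⟩
  have hpt : ∀ x, ‖vel L Lb t x‖ₑ ^ 2 ≤ B.indicator (fun _ => ENNReal.ofReal (TowerRates.wide.Y 0) ^ 2) x := by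
    intro x
    by_cases hx : x ∈ B
    · rw [indicator_of_mem hx, ← ofReal_norm]
      exact pow_le_pow_left' (ENNReal.ofReal_le_ofReal (norm_vel_le hL hLb hslab t x)) 2
    · have hx' : radius L Lb < ‖x‖ := by
        rw [hB, Metric.mem_closedBall, dist_zero_right, not_le] at hx
        exact hx
      rw [vel_eq_zero_of_far hL hLb hx' t, indicator_of_notMem hx]
      simp
  calc ∫⁻ x, ‖vel L Lb t x‖ₑ ^ 2 ≤ ∫⁻ x, B.indicator (fun _ => ENNReal.ofReal (TowerRates.wide.Y 0) ^ 2) x :=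
        lintegral_mono hpt
    _ = ENNReal.ofReal (TowerRates.wide.Y 0) ^ 2 * volume B :=
        lintegral_indicator_const measurableSet_closedBall _

/-- The floor point `c + L_b x⋆` is off the slab (`L_b > 0`, `L ≥ 0`). [folklore] -/
theorem floorPoint_off_slab (hL : 0 ≤ L) (hLb : 0 < Lb) : 2 * L < ‖center L Lb + Lb • thetaArgmax‖ := by
  have h1 : ‖center L Lb‖ - ‖Lb • thetaArgmax‖ ≤ ‖center L Lb + Lb • thetaArgmax‖ := by
    have := norm_sub_le (center L Lb + Lb • thetaArgmax) (Lb • thetaArgmax)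
    rw [add_sub_cancel_right] at this
    linarith
  have h2 : ‖Lb • thetaArgmax‖ ≤ 2 * Lb := by
    rw [norm_smul, Real.norm_eq_abs, abs_of_pos hLb]
    nlinarith [norm_thetaArgmax_le, norm_nonneg thetaArgmax]
  rw [norm_center hL hLb.le] at h1
  linarith

/-- The floor point lies in the carrying ball. [folklore] -/
theorem norm_floorPoint_le (hL : 0 ≤ L) (hLb : 0 < Lb) :
    ‖center L Lb + Lb • thetaArgmax‖ ≤ radius L Lb := by
  have h1 := norm_add_le (center L Lb) (Lb • thetaArgmax)
  have h2 : ‖Lb • thetaArgmax‖ ≤ 2 * Lb := by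
    rw [norm_smul, Real.norm_eq_abs, abs_of_pos hLb]
    nlinarith [norm_thetaArgmax_le, norm_nonneg thetaArgmax]
  rw [norm_center hL hLb.le] at h1
  show _ ≤ 2 * L + 4 * Lb + 2
  linarith

/-- **THE VELOCITY FLOOR at `t = 1`**: `‖u(1, c + L_b x⋆)‖ = Y₀`. [folklore] -/
theorem norm_vel_floorPoint (hL : 0 < L) (hLb : 0 < Lb) :
    ‖vel L Lb 1 (center L Lb + Lb • thetaArgmax)‖ = TowerRates.wide.Y 0 := by
  rw [vel_off_slab hL (floorPoint_off_slab hL.le hLb), norm_smul, aProf_of_one_le le_rfl,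
    Real.norm_eq_abs, abs_of_pos ampBump_pos, bumpF, norm_place_theta_argmax _ hLb.ne',
    ampBump_mul_thetaMax]

/-- The origin lies on the slab's plateau (`L ≥ 1`). [folklore] -/
theorem eventually_cutoff_eq_one_zero (hL : 1 ≤ L) : ∀ᶠ y in 𝓝 (0 : ℝ³), cutoff L y = 1 :=
  eventually_cutoff_eq_one (by linarith) (by rw [norm_zero]; linarith)

/-- The origin is off the bump. [folklore] -/
theorem origin_off_bump (hL : 0 ≤ L) (hLb : 0 ≤ Lb) : 2 * Lb < ‖(0 : ℝ³) - center L Lb‖ := by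
  rw [zero_sub, norm_neg, norm_center hL hLb]
  linarith

/-- **THE STRAIN FLOOR at `t = 1`**: `‖Du(1)(0)‖ ≥ A₀` (`Du(1)(0) = b₀ λ · D(wave λ)(0)`,
`‖D wave‖ ≥ λ`, `b₀ λ² = (Y₀/2)(2N₀) = N₀ Y₀ = A₀`). [folklore] -/
theorem strain_vel (hL : 1 ≤ L) (hLb : 1 ≤ Lb) :
    TowerRates.wide.A 0 ≤ ‖fderiv ℝ (vel L Lb 1) (0 : ℝ³)‖ := by
  have hb0 := (bump_zero (L := L) (by linarith : (0 : ℝ) < Lb)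
    (origin_off_bump (by linarith) (by linarith))).2.1
  have hs0 : fderiv ℝ (slab L) 0 = freq • fderiv ℝ (wave freq) 0 :=
    fderiv_packet_of_plateau (differentiable_cutoff L) (eventually_cutoff_eq_one_zero hL)
  have h0 : ampBump • (0 : ℝ³ →L[ℝ] ℝ³) = 0 := by ext1 v; simp
  have hD : fderiv ℝ (vel L Lb 1) (0 : ℝ³) = (ampSlab * freq) • fderiv ℝ (wave freq) 0 := by
    rw [fderiv_vel, aProf_of_one_le le_rfl, bProf_one, hb0, hs0, smul_smul, h0, zero_add]
  rw [hD, norm_smul, Real.norm_eq_abs, abs_of_pos (mul_pos ampSlab_pos freq_pos)]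
  have h1 := le_norm_fderiv_wave freq (0 : ℝ³)
  rw [abs_of_pos freq_pos] at h1
  have h2 : TowerRates.wide.A 0 = ampSlab * freq * freq := by
    rw [wide_A_zero_eq, ampSlab_mul_freq, freq_eq]
    ring
  rw [h2]
  exact mul_le_mul_of_nonneg_left h1 (mul_pos ampSlab_pos freq_pos).le

end Flow

end Summit.NavierStokesRegularity.FluidComputer.PalasekTowerClayBridge.Host

end
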